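import Mathlib
import HarnessLib
import Summits.AtomisticToContinuum.BoseEinsteinCondensation.Theses.BECGroundStateSOS
import Literature.MathematicalPhysics.QuantumManyBody.PeriodicBoseGasMomentumSector
import Literature.MathematicalPhysics.QuantumLattice.FinDimSpectrumProofs
import Literature.MathematicalPhysics.QuantumLattice.XYOrder

/-!
# Crux-ideate sketches for `PeriodicIRBound` (stmt-AtomisticToContinuum-3972), ideator 1, round 1

First lemmas of the two idea cards filed by this seat:

* `linear-ph-floor-wagner` (§A): the number-changing Wagner–Feynman two-sided Markov bound
  (`wagner_twoSided`, finite-dimensional shadow, PROVED sorry-free), the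
  transfer target `LinearParticleHoleFloor` (typed over `momentumSectorEnergy`), the integrable /
  hard-core halves of the crux and the case glue to the route decl `PeriodicIRBound` BY NAME.
* `dielectric-basis-certificate` (§B): soundness of ground-state-cone certificates WITH the
  commutator gauge term `i[H,C]` (`coneCertificate_sound`, PROVED sorry-free), and the lattice continuity equation
  (Ward identity) of the XY benchmark defining the hydrodynamic operator basis
  (`xy_lattice_continuity`).
-/

noncomputable section

open scoped BigOperators ENNReal Matrix ComplexOrder
open Filter MeasureTheory

namespace Summit.AtomisticToContinuum.BoseEinsteinCondensation.Cruxes.PeriodicIRBound.Ideator1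

/-! ## §A  Card `linear-ph-floor-wagner` -/

section Wagner

variable {n : Type*} [Fintype n]

open Matrix

/-- Adjoint identity for the dot-product pairing: `⟨ψ, a w⟩ = ⟨aᴴ ψ, w⟩`. [folklore] -/
theorem star_dot_mulVec (a : Matrix n n ℂ) (ψ w : n → ℂ) :
    star ψ ⬝ᵥ (a *ᵥ w) = star (aᴴ *ᵥ ψ) ⬝ᵥ w := by
  rw [dotProduct_mulVec, star_mulVec, conjTranspose_conjTranspose]

/-- **Two-sided Markov / Wagner–Feynman bound (finite-dimensional shadow, PROVED).** `H`
Hermitian, `H ψ = E ψ`, `a` any operator (think: `a = a(φ_k)` on `ℋ_{N-1} ⊕ ℋ_N ⊕ ℋ_{N+1}`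
truncated). If the hole state `aψ` has mean energy `≥ E + ωm` and the particle state `aᴴψ` has
mean energy `≥ E + ωp` (sector floors, `ωm = ω_{N-1}(k) - μ_N`, `ωp = ω_{N+1}(k) + μ_{N+1}`), then
`ωm‖aψ‖² + ωp‖aᴴψ‖² ≤ ⟨ψ, [a,[H,aᴴ]] ψ⟩`, i.e. `n_k·Γ_N(k) ≤ D_k - ω_{N+1}(k) - μ_{N+1}` with
`Γ_N(k) = E_{N+1}(k) + E_{N-1}(k) - 2E₀(N)` (the chemical potentials cancel). [Wagner1966;
Stringari1995 §2.2 (16); PitaevskiiStringari1991] -/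
theorem wagner_twoSided (H a : Matrix n n ℂ) (ψ : n → ℂ) (E ωm ωp : ℝ)
    (hH : H.IsHermitian) (hψ : H *ᵥ ψ = (E : ℂ) • ψ)
    (hm : (E + ωm) * (star (a *ᵥ ψ) ⬝ᵥ (a *ᵥ ψ)).re ≤
      (star (a *ᵥ ψ) ⬝ᵥ (H *ᵥ (a *ᵥ ψ))).re)
    (hp : (E + ωp) * (star (aᴴ *ᵥ ψ) ⬝ᵥ (aᴴ *ᵥ ψ)).re ≤
      (star (aᴴ *ᵥ ψ) ⬝ᵥ (H *ᵥ (aᴴ *ᵥ ψ))).re) :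
    ωm * (star (a *ᵥ ψ) ⬝ᵥ (a *ᵥ ψ)).re + ωp * (star (aᴴ *ᵥ ψ) ⬝ᵥ (aᴴ *ᵥ ψ)).re ≤
      (star ψ ⬝ᵥ ((a * (H * aᴴ) - a * (aᴴ * H) - (H * aᴴ * a - aᴴ * (H * a))) *ᵥ ψ)).re := by
  -- ⟨ψ, H w⟩ = E ⟨ψ, w⟩ for the eigenvector ψ of the Hermitian H
  have hHψ : ∀ w : n → ℂ, star ψ ⬝ᵥ (H *ᵥ w) = (E : ℂ) * (star ψ ⬝ᵥ w) := by
    intro w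
    rw [star_dot_mulVec, hH.eq, hψ, star_smul, smul_dotProduct, smul_eq_mul,
      Complex.star_def, Complex.conj_ofReal]
  have h1 : star ψ ⬝ᵥ ((a * (H * aᴴ)) *ᵥ ψ) = star (aᴴ *ᵥ ψ) ⬝ᵥ (H *ᵥ (aᴴ *ᵥ ψ)) := by
    rw [← mulVec_mulVec, ← mulVec_mulVec, star_dot_mulVec]
  have h2 : star ψ ⬝ᵥ ((a * (aᴴ * H)) *ᵥ ψ) = (E : ℂ) * (star (aᴴ *ᵥ ψ) ⬝ᵥ (aᴴ *ᵥ ψ)) := by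
    rw [← mulVec_mulVec, ← mulVec_mulVec, hψ, mulVec_smul, mulVec_smul, dotProduct_smul,
      star_dot_mulVec, smul_eq_mul]
  have h3 : star ψ ⬝ᵥ ((H * aᴴ * a) *ᵥ ψ) = (E : ℂ) * (star (a *ᵥ ψ) ⬝ᵥ (a *ᵥ ψ)) := by
    rw [← mulVec_mulVec, ← mulVec_mulVec, hHψ, star_dot_mulVec aᴴ, conjTranspose_conjTranspose]
  have h4 : star ψ ⬝ᵥ ((aᴴ * (H * a)) *ᵥ ψ) = star (a *ᵥ ψ) ⬝ᵥ (H *ᵥ (a *ᵥ ψ)) := by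
    rw [← mulVec_mulVec, ← mulVec_mulVec, star_dot_mulVec aᴴ, conjTranspose_conjTranspose]
  rw [sub_mulVec, sub_mulVec, sub_mulVec, dotProduct_sub, dotProduct_sub, dotProduct_sub,
    h1, h2, h3, h4]
  simp only [Complex.sub_re, Complex.mul_re, Complex.ofReal_re, Complex.ofReal_im, zero_mul,
    sub_zero]
  rw [add_mul] at hm hp
  linarith

end Wagner

open Literature.MathematicalPhysics.QuantumManyBody.BoseGas

/-- **Transfer target `C⁺` (LINEAR particle–hole sector floor).** For every repulsive
finite-range `v` with `∫v ≠ 0` and every window constant `C > 0` there are `θ, ρ₀ > 0` with: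
for `ρ < ρ₀`, eventually in `N`, for every `k ≠ 0` with `‖k‖² ≤ Cρ`,
`2E₀^per(N,L) + 2θ√ρ‖k‖ ≤ E^per_{N+1}(k;L) + E^per_{N-1}(k;L)`, `L = (N/ρ)^{1/3}`,
`E^per_M(k;L) = momentumSectorEnergy v M L k`. Same shape as `BECNoCheapMomentum.SectorGapFloor`
(stmt-11843) with the quadratic floor `2κ‖k‖²` replaced by the LINEAR one — the weakest floor that
yields the crux's exponent `1`; it follows from `BECSectorPoincareTwoScale.LandauSectorBound`
(stmt-9091, applied at `M = N ± 1` inside its density window `ρ/2 ≤ M/L³ ≤ 2ρ`) plus midpoint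
near-convexity `E₀(N+1)+E₀(N-1)-2E₀(N) ≥ -o(√ρ/L)`. [conjecture; CorneanDerezinskiZin2009 §1.1
(1.6) for the sector energies] -/
def LinearParticleHoleFloor : Prop :=
  ∀ v : ℝ → ℝ≥0∞, IsRepulsiveFiniteRange v → (∫⁻ x : EuclideanSpace ℝ (Fin 3), v ‖x‖) ≠ 0 →
    ∀ C : ℝ, 0 < C → ∃ θ : ℝ, 0 < θ ∧ ∃ ρ₀ : ℝ, 0 < ρ₀ ∧ ∀ ρ : ℝ, 0 < ρ → ρ < ρ₀ →
      ∀ᶠ N : ℕ in Filter.atTop, ∀ k : EuclideanSpace ℝ (Fin 3), k ≠ 0 → ‖k‖ ^ 2 ≤ C * ρ →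
        2 * periodicGroundStateEnergy v N (sideLength ρ N) +
            ENNReal.ofReal (2 * θ * Real.sqrt ρ * ‖k‖) ≤
          momentumSectorEnergy v (N + 1) (sideLength ρ N) k +
            momentumSectorEnergy v (N - 1) (sideLength ρ N) k

/-- Zero-momentum uniqueness of the torus ground state for integrable potentials (verbatim the
mathematics of `BECNoCheapMomentum.ZeroMomentumGround`, stmt of that route, restated over
`momentumSectorEnergy`): strict gap to every nonzero momentum sector at fixed `(N, L)`
(Perron–Frobenius; needed to pass from the exact ground state to `δ`-near-minimisers, `δ` after
`N`). [ReedSimonIV1978 XIII.44–47; folklore] -/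
def ZeroMomentumGround : Prop :=
  ∀ v : ℝ → ℝ≥0∞, IsRepulsiveFiniteRange v → (∫⁻ x : EuclideanSpace ℝ (Fin 3), v ‖x‖) ≠ ⊤ →
    ∀ (N : ℕ) (L : ℝ), 0 < L → ∀ q : EuclideanSpace ℝ (Fin 3), q ≠ 0 →
      periodicGroundStateEnergy v N L < momentumSectorEnergy v N L q

/-- The crux `PeriodicIRBound` restricted to INTEGRABLE potentials (`∫v < ∞`): body copied from
`BECGroundStateSOS.PeriodicIRBound` with the extra hypothesis `(∫⁻ v) ≠ ⊤`. [conjecture] -/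
def PeriodicIRBoundIntegrable : Prop :=
  ∀ v : ℝ → ENNReal, IsRepulsiveFiniteRange v → (∫⁻ x : EuclideanSpace ℝ (Fin 3), v ‖x‖) ≠ ⊤ →
    ∀ κ : ℝ, 0 < κ → ∃ ρ₀ : ℝ, 0 < ρ₀ ∧ ∃ C : ℝ, 0 < C ∧ ∀ ρ : ℝ, 0 < ρ → ρ < ρ₀ →
      ∀ᶠ N : ℕ in Filter.atTop, ∃ δ : ENNReal, 0 < δ ∧
        ∀ Ψ : PeriodicTrialState N (sideLength ρ N),
          periodicEnergy v Ψ ≤ periodicGroundStateEnergy v N (sideLength ρ N) + δ →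
            ∀ k : Fin 3 → ℤ, k ≠ 0 → ‖(fun j => (k j : ℝ))‖ ≤ κ * Real.sqrt ρ * sideLength ρ N →
              cellOccupation N (sideLength ρ N)
                  (fun x => ((Real.sqrt (sideLength ρ N ^ 3))⁻¹ : ℂ) *
                    cellWave (sideLength ρ N) k x) Ψ.ψ ≤
                ENNReal.ofReal (C * Real.sqrt ρ * sideLength ρ N / ‖(fun j => (k j : ℝ))‖)

/-- The crux restricted to NON-integrable (hard-core) potentials `∫v = ∞`; to be fed by the
Jastrow-dressed version of the moment bound (cf. `BECNoCheapMomentum.HardCoreMomentBound`) or by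
the shared `ScatteringLengthTransfer` item. [conjecture] -/
def PeriodicIRBoundHardCore : Prop :=
  ∀ v : ℝ → ENNReal, IsRepulsiveFiniteRange v → (∫⁻ x : EuclideanSpace ℝ (Fin 3), v ‖x‖) = ⊤ →
    ∀ κ : ℝ, 0 < κ → ∃ ρ₀ : ℝ, 0 < ρ₀ ∧ ∃ C : ℝ, 0 < C ∧ ∀ ρ : ℝ, 0 < ρ → ρ < ρ₀ →
      ∀ᶠ N : ℕ in Filter.atTop, ∃ δ : ENNReal, 0 < δ ∧
        ∀ Ψ : PeriodicTrialState N (sideLength ρ N),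
          periodicEnergy v Ψ ≤ periodicGroundStateEnergy v N (sideLength ρ N) + δ →
            ∀ k : Fin 3 → ℤ, k ≠ 0 → ‖(fun j => (k j : ℝ))‖ ≤ κ * Real.sqrt ρ * sideLength ρ N →
              cellOccupation N (sideLength ρ N)
                  (fun x => ((Real.sqrt (sideLength ρ N ^ 3))⁻¹ : ℂ) *
                    cellWave (sideLength ρ N) k x) Ψ.ψ ≤
                ENNReal.ofReal (C * Real.sqrt ρ * sideLength ρ N / ‖(fun j => (k j : ℝ))‖)

/-- **First lemma of card `linear-ph-floor-wagner` (the line's load-bearing implication).**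
LINEAR particle–hole floor + zero-momentum uniqueness ⇒ the crux on the integrable class:
Wagner–Feynman for the exact torus ground state `Ψ₀`
(`n_k Γ_N(k) ≤ ⟨[[a_k,H],a_k†]⟩ = k² + L⁻³(v̂(0)N + Σ_q v̂(q-k)n_q) ≤ k² + 2ρ‖v‖₁`), hence
`n_k ≤ (k² + 2ρ‖v‖₁)/(2θ√ρ‖k‖) ≤ (12π²κ² + 2‖v‖₁)√ρ/(2θ‖k‖)` on `‖k‖_∞ ≤ κ√ρ L`
(`‖k‖ = 2π‖k_int‖₂/L`), which is `C√ρL/‖k_int‖`; transfer to `δ`-near-minimisers by the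
fixed-`(N,L)` gap (`δ` after `N`); the free gas `∫v = 0` separately (`E₀ = 0`,
`n_k ≤ δL²/4π²‖k‖²`). [conjecture-level implication; M-sized, provable for `v ∈ L¹`] -/
theorem periodicIRBoundIntegrable_of_linearFloor
    (hΓ : LinearParticleHoleFloor) (h0 : ZeroMomentumGround) : PeriodicIRBoundIntegrable := by
  sorry

/-- Case glue to the route decl BY NAME: the two halves give the crux
`BECGroundStateSOS.PeriodicIRBound` (trichotomy-free: `∫v = ⊤` or not). [folklore] -/
theorem periodicIRBound_of_halves (h₁ : PeriodicIRBoundIntegrable) (h₂ : PeriodicIRBoundHardCore) :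
    Summit.AtomisticToContinuum.BoseEinsteinCondensation.Theses.BECGroundStateSOS.PeriodicIRBound := by
  intro v hv κ hκ
  by_cases htop : (∫⁻ x : EuclideanSpace ℝ (Fin 3), v ‖x‖) = ⊤
  · exact h₂ v hv htop κ hκ
  · exact h₁ v hv htop κ hκ

/-! ## §B  Card `dielectric-basis-certificate` -/

section Cone

variable {m : Type*} [Fintype m] [DecidableEq m]

open Matrix Literature.MathematicalPhysics.QuantumLattice

/-- **Soundness of a ground-state-cone certificate with commutator gauge term.** If
`c·1 - O = Σ_j B_jᴴ B_j + Σ_i λ_i A_iᴴ (H A_i - A_i H) + (H C - C H)` with `λ_i ≥ 0`, then the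
tracial ground-state functional obeys `Re ω₀(O) ≤ c`: `ω₀(BᴴB) ≥ 0`, `ω₀(Aᴴ[H,A]) =
ω₀(Aᴴ(H-E₀)A) ≥ 0`, `ω₀([H,C]) = 0`. The `i[H,C]` term is what carries the Bogoliubov pairing
gauge `C_k ∝ i(β_k†β_{-k}† - β_{-k}β_k)` in the rotated certificate of the card.
[BratteliRobinsonII1997 §5.3.1; FawziFawziScalet2024; Tasaki2020 §2.1] -/
theorem coneCertificate_sound [Nonempty m] {H : Matrix m m ℂ} (hH : H.IsHermitian)
    (O C : Matrix m m ℂ) (c : ℝ) {ι κ : Type*} (sB : Finset ι) (sA : Finset κ)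
    (B : ι → Matrix m m ℂ) (A : κ → Matrix m m ℂ) (lam : κ → ℝ) (hlam : ∀ i ∈ sA, 0 ≤ lam i)
    (hcert : (c : ℂ) • (1 : Matrix m m ℂ) - O =
      ∑ j ∈ sB, (B j)ᴴ * B j + ∑ i ∈ sA, (lam i : ℂ) • ((A i)ᴴ * (H * A i - A i * H)) +
        (H * C - C * H)) :
    (H.groundStateFunctional O).re ≤ c := by
  -- each cone element has non-negative expectation
  have hB : ∀ j, 0 ≤ H.groundStateFunctional ((B j)ᴴ * B j) :=
    fun j => groundStateFunctional_nonneg H (B j)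
  have hA : ∀ i, 0 ≤ H.groundStateFunctional ((A i)ᴴ * (H * A i - A i * H)) := by
    intro i
    have hps : ((A i)ᴴ * (H - algebraMap ℝ (Matrix m m ℂ) H.groundEnergy) * A i).PosSemidef :=
      (posSemidef_sub_groundEnergy hH).conjTranspose_mul_mul_same (A i)
    have h0 := groundStateFunctional_nonneg_of_posSemidef H hps
    have e1 : H.groundStateFunctional ((A i)ᴴ * (H * A i - A i * H)) =
        H.groundStateFunctional ((A i)ᴴ * H * A i) -
          (H.groundEnergy : ℂ) * H.groundStateFunctional ((A i)ᴴ * A i) := by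
      rw [mul_sub, map_sub, ← mul_assoc, ← mul_assoc, groundStateFunctional_mul_hamiltonian]
    have e2 : H.groundStateFunctional ((A i)ᴴ * (H - algebraMap ℝ (Matrix m m ℂ) H.groundEnergy) * A i) =
        H.groundStateFunctional ((A i)ᴴ * H * A i) -
          (H.groundEnergy : ℂ) * H.groundStateFunctional ((A i)ᴴ * A i) := by
      rw [Algebra.algebraMap_eq_smul_one, mul_sub, sub_mul, map_sub, mul_smul_comm, mul_one,
        smul_mul_assoc, LinearMap.map_smul_of_tower, Complex.real_smul]
    rw [e1, ← e2]
    exact h0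
  have hC : H.groundStateFunctional (H * C - C * H) = 0 := by
    rw [map_sub, groundStateFunctional_hamiltonian_mul hH, groundStateFunctional_mul_hamiltonian,
      sub_self]
  -- apply ω to the certificate
  have happ := congrArg H.groundStateFunctional hcert
  rw [map_sub, map_add, map_add, map_sum, map_sum, hC, add_zero, LinearMap.map_smul_of_tower,
    groundStateFunctional_one hH] at happ
  -- real parts
  have hre := congrArg Complex.re happ
  simp only [Complex.sub_re, Complex.add_re, Complex.re_sum, map_smul, smul_eq_mul, mul_one,
    Complex.ofReal_re, Complex.mul_re, Complex.ofReal_im, zero_mul, sub_zero] at hre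
  have hsum1 : 0 ≤ ∑ j ∈ sB, (H.groundStateFunctional ((B j)ᴴ * B j)).re :=
    Finset.sum_nonneg fun j _ => (Complex.nonneg_iff.mp (hB j)).1
  have hsum2 : 0 ≤ ∑ i ∈ sA, lam i * (H.groundStateFunctional ((A i)ᴴ * (H * A i - A i * H))).re :=
    Finset.sum_nonneg fun i hi => mul_nonneg (hlam i hi) (Complex.nonneg_iff.mp (hA i)).1
  linarith

end Cone

section Lattice

open Matrix Literature.MathematicalPhysics.QuantumLattice Literature.Probability.LatticeModels

variable (d L n : ℕ) [NeZero L]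

/-- **Lattice continuity equation (Ward identity) of the XY benchmark.** For the KLS Hamiltonian
`H = -Σ_{⟨xy⟩}(S¹_xS¹_y + S²_xS²_y)` on the torus `(ℤ/Lℤ)^d` and every site `x`:
`[H, S³_x] = Σ_{y ∼ x} i (S²_x S¹_y - S¹_x S²_y)` — the lattice divergence of the bond (spin)
current; the family `{S³_x, J_{xy}}` is the "hydrodynamic" operator basis the card prescribes
for `q`-uniform certificates (sign convention of `spin_commutation`). [KLS1988PRL eq. (1);
Griffin1993 Ch. 5 (5.17)–(5.19), p. 112; folklore] -/
theorem xy_lattice_continuity (x : TorusSite d L) :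
    xyTorus d L n * siteSpin n x 2 - siteSpin n x 2 * xyTorus d L n =
      ∑ y ∈ (torusGraph d L).neighborFinset x,
        Complex.I • (siteSpin n x 1 * siteSpin n y 0 - siteSpin n x 0 * siteSpin n y 1) := by
  sorry

end Lattice

end Summit.AtomisticToContinuum.BoseEinsteinCondensation.Cruxes.PeriodicIRBound.Ideator1
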